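import Summits.MatrixMultiplication.OmegaCensus.SimplifiableSUSPOmegaBound
import Summits.MatrixMultiplication.OmegaCensus.StrongUSPCapacityOmegaBound
import HarnessLib

/-!
# ω-census, family (b′) STPP / USP: a simplifiable `(s,k)`-SUSP witnesses strong USP capacity `≥ s^{1/k}`
(Anderson–Le 2023, §4.2 / Corollary 5, in the capacity language of CKSU Corollary 16)

HONEST FRAMING (pub-omega census; verbatim): lottery ticket; floor = certified bounds/negative ranges.
Census BOOKKEEPING, not progress on `ω` (tree: `ω < 2.373`).

Anderson–Le (arXiv:2307.06463) §4.2, AS PRINTED: "For a puzzle `P`, we can define the infinite family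
`F_P = {P^m | m ∈ ℕ}`. Observe that `F_P` has capacity `(s^m)^{1/(k·m)} = s^{1/k}` matching the capacity of `P`." and
Corollary 5: "Let `P` be a simplifiable SUSP, `P` generates an infinite family of simplifiable SUSPs."  With the tree's
`IsSimplifiable.pow` / `.reindex` / `.isStrongUSP` (`Literature/…/SimplifiableSUSP.lean`) this is the statement that every
power `P^N` is a strong USP of `s^N` rows and width `N k` (`exists_isStrongUSP_pow_of_isSimplifiable`), i.e. exactly the
lower-bound half of "the strong USP capacity is at least `s^{1/k}`" in the form used by the tree's CKSU Cor. 16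
(`omega_le_of_strongUSPCapacity_ge`, `StrongUSPCapacityOmegaBound.lean`): `strongUSPCapacity_ge_of_isSimplifiable`.
Feeding it to that corollary re-derives Anderson–Le's Theorem 2 in CKSU's capacity form
(`omega_le_of_isSimplifiable_capacityForm`: `ω ≤ 3 (log m − log s^{1/k}) / log (m − 1)`), a second route to the tree's
`omega_le_of_isSimplifiable`.

References: M. Anderson, V. Le, arXiv:2307.06463, §4.2, Cor. 5, Thm. 2 [AndersonLe2023]; H. Cohn, R. Kleinberg, B. Szegedy,
C. Umans, arXiv:math/0511460, Cor. 16 [CohnKleinbergSzegedyUmans2005].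
-/

noncomputable section

namespace Summit.MatrixMultiplication.OmegaCensus

open Literature.Computability.AlgebraicComplexity

/-- **AL §4.2 / Cor. 5: every power of a simplifiable puzzle is a strong USP** — `P^N` has `s^N` rows and width `N k`.
[cite: AndersonLe2023, §4.2 and Corollary 5] -/
theorem exists_isStrongUSP_pow_of_isSimplifiable {s k : ℕ} {row : Fin s → Fin k → Fin 3} (hU : IsSimplifiable row)
    (N : ℕ) : ∃ row' : Fin (s ^ N) → Fin (N * k) → Fin 3, IsStrongUSP row' :=
  ⟨_, ((hU.pow N).reindex finFunctionFinEquiv.symm finProdFinEquiv.symm).isStrongUSP⟩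

/-- **"`F_P` has capacity `s^{1/k}`"** (AL §4.2) in the tree's capacity language: a simplifiable puzzle of `s ≥ 1` rows and
width `k ≥ 1` gives, for every `0 < C' < s^{1/k}` and every `K`, a strong USP of some width `k' ≥ K` with at least `C'^{k'}`
rows (namely `P^{K+1}`: width `(K+1) k`, `s^{K+1} = (s^{1/k})^{(K+1)k} ≥ C'^{(K+1)k}` rows) — the hypothesis of
`omega_le_of_strongUSPCapacity_ge` with `C = s^{1/k}`. [cite: AndersonLe2023, §4.2 and Corollary 5] -/
theorem strongUSPCapacity_ge_of_isSimplifiable {s k : ℕ} {row : Fin s → Fin k → Fin 3} (hU : IsSimplifiable row)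
    (hs : 0 < s) (hk : 0 < k) :
    ∀ C' : ℝ, 0 < C' → C' < (s : ℝ) ^ ((1 : ℝ) / k) → ∀ K : ℕ, ∃ k' : ℕ, K ≤ k' ∧ ∃ s' : ℕ,
      ∃ row' : Fin s' → Fin k' → Fin 3, IsStrongUSP row' ∧ C' ^ k' ≤ (s' : ℝ) := by
  intro C' hC' hlt K
  obtain ⟨row', h'⟩ := exists_isStrongUSP_pow_of_isSimplifiable hU (K + 1)
  refine ⟨(K + 1) * k, ?_, s ^ (K + 1), row', h', ?_⟩
  · nlinarith
  · have hs' : (0 : ℝ) ≤ (s : ℝ) := by positivity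
    have hk' : (k : ℝ) ≠ 0 := by exact_mod_cast hk.ne'
    have hpow : ((s : ℝ) ^ ((1 : ℝ) / k)) ^ ((K + 1) * k) = (s : ℝ) ^ (K + 1) := by
      rw [← Real.rpow_natCast, ← Real.rpow_mul hs']
      have e : (1 : ℝ) / k * (((K + 1) * k : ℕ) : ℝ) = ((K + 1 : ℕ) : ℝ) := by
        push_cast; field_simp
      rw [e, Real.rpow_natCast]
    calc C' ^ ((K + 1) * k) ≤ ((s : ℝ) ^ ((1 : ℝ) / k)) ^ ((K + 1) * k) :=
          pow_le_pow_left₀ hC'.le hlt.le _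
      _ = (s : ℝ) ^ (K + 1) := hpow
      _ = ((s ^ (K + 1) : ℕ) : ℝ) := by push_cast; ring

/-- **Anderson–Le Theorem 2 in CKSU's capacity form** (CKSU Cor. 16, second sentence, with `C = s^{1/k}`): a simplifiable
puzzle of `s ≥ 1` rows and width `k ≥ 1` gives, for every `m ≥ 3`, `ω ≤ 3 (log m − log s^{1/k}) / log (m − 1)` — a
second route (via `omega_le_of_strongUSPCapacity_ge`) to `omega_le_of_isSimplifiable`.
[cite: AndersonLe2023, Theorem 2] [cite: CohnKleinbergSzegedyUmans2005, Corollary 16 (§3.3)] -/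
theorem omega_le_of_isSimplifiable_capacityForm {s k : ℕ} {row : Fin s → Fin k → Fin 3} (hU : IsSimplifiable row)
    (hs : 0 < s) (hk : 0 < k) {m : ℕ} (hm : 3 ≤ m) :
    omega ℂ ≤ 3 * (Real.log m - Real.log ((s : ℝ) ^ ((1 : ℝ) / k))) / Real.log ((m : ℝ) - 1) :=
  omega_le_of_strongUSPCapacity_ge (Real.rpow_pos_of_pos (by exact_mod_cast hs) _)
    (strongUSPCapacity_ge_of_isSimplifiable hU hs hk) hm

end Summit.MatrixMultiplication.OmegaCensus

end
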